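import Literature.Probability.Percolation.QuadCrossingContinuityOfLemma51
import HarnessLib

/-!
# Rotation invariance of quad-crossing probabilities: all angles, the per-angle form of
# DKKMO v2, and uniformity in the angle from Schramm–Smirnov continuity

Topic `Probability/Percolation`; proofs file of `QuadCrossingRotationInvariance.lean` (the named
fact `dkkmo_crossing_rotation_invariance`: Duminil-Copin–Kozlowski–Krachun–Manolescu–Oulamara,
arXiv:2012.11672v1 (2020), Corollary 1.3 at `q = 1`, per quad `Q`: for every `ε > 0` there is
`δ₀ = δ₀(Q, ε) > 0` with `|P_{1/2}[𝒞_δ(e^{iα}Q)] - P_{1/2}[𝒞_δ(Q)]| ≤ ε` for all `α ∈ (ε, π - ε)`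
and `δ ∈ (0, δ₀)` — UNIFORM in the angle).  The second arXiv version (v2, 30 June 2026) restates the
corollary PER ANGLE (Cor. 1.3 there: for `Q ⊂ Ω` and each `α ∈ [0, π]`,
`φ⁰_{(e^{iα}Ω)_δ}[𝒞(e^{iα}Q)] - φ⁰_{Ω_δ}[𝒞(Q)] → 0` as `δ → 0`) and remarks "The convergence in
Corollary 1.3 may be proved to be uniform in `α ∈ [0, π]`".  This file relates the two forms for
critical bond percolation on `δℤ²` (`q = 1`, `Ω = ℝ²`), with everything proved:

* `dkkmo_crossing_rotation_invariance.forall_angle` — the vendored (v1) statement gives the bound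
  for ALL real angles at once (the angles near `0` and `π` that `(ε, π - ε)` omits are congruent
  modulo `π/2` to angles near `π/2`, and `P_{1/2}[𝒞_δ(e^{iα}Q)]` has period `π/2` in `α` by the
  symmetries of `ℤ²`, `quadCrossingProb_rotateQuad_add_int_mul_pi_div_two`); this is the "transfer
  to all angles left to consumers" of the fact's docstring;
* `dkkmo_crossing_rotation_invariance.tendsto_sub` — hence the per-angle form of v2's Cor. 1.3
  (`q = 1`, full plane) for every real angle;
* `dkkmo_crossing_rotation_invariance_of_tendsto_of_continuity` — **conversely, v2's per-angle
  statement on `[0, π]` implies the uniform (v1) statement**, given the continuity of the crossing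
  event of a fixed quad in the discrete form (5.1) of Schramm–Smirnov (for every quad `Q₀ ∈ 𝒬_ℂ`
  and `ε > 0` there are `Q' < Q₀ < Q''` and `δ₀ > 0` with
  `P_{1/2}[Q' crossed inside the open edges ∧ Q'' not] ≤ ε` for `0 < δ < δ₀` — literally the
  hypothesis `hcont` of `dkkmo_crossing_rotation_invariance_of_schrammSmirnov` and of
  `SchrammSmirnov2011_lemma_5_1_of_continuity` at `D = univ`), and
  `dkkmo_crossing_rotation_invariance_of_tendsto_of_lemma_5_1` — the same with the named fact
  `SchrammSmirnov2011_lemma_5_1` (through `Quad.continuity_of_lemma_5_1`).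

Proof of the converse (the remark after v2's Cor. 1.3, which the source does not prove; standard
compactness).  Let `Q ∈ 𝒬_ℂ` be the quad of `R` (`squareModelQuad`) and `Q^θ = e^{iθ} ∘ Q` the quad
of `e^{iθ}R` (its carrier and sides are those of `e^{iθ}R`, as in
`QuadCrossingRotationInvarianceOfThm21.lean`); `θ ↦ Q^θ` is continuous into `𝒬_ℂ` (uniform
metric, `Quad.continuous_mapHomeomorph_rotation`).  For each `θ` take
`Q'_θ < Q^θ < Q''_θ` and `δ_θ` from (5.1) at `ε/3`; the set `U_θ = {β : Q'_θ < Q^β < Q''_θ}` is an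
open neighbourhood of `θ` (`<` is open in each variable), and for `β, β' ∈ U_θ` and `0 < δ < δ_θ`,
`𝒞_δ(e^{iβ}R) ∖ 𝒞_δ(e^{iβ'}R) ⊆ {Q'_θ crossed inside the open edges ∧ Q''_θ not}`
(`quadCrossing_rotateQuad_diff_subset`: a path crossing of `e^{iβ}R` puts `Q^β` in `S_ω`, hence a
raw crossing of `Q'_θ < Q^β`; a raw crossing of `Q''_θ > Q^{β'}` would give a path crossing of
`e^{iβ'}R`, `QuadCrossingPathCrossings`), so the crossing probabilities of `e^{iβ}R`, `e^{iβ'}R`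
differ by at most `ε/3`.  Finitely many `U_{θ_i}` cover the compact `[0, π]`; with the per-angle
convergence at the finitely many `θ_i` (and `δ` below all the `δ_{θ_i}` and the pointwise
thresholds), `|P[𝒞_δ(e^{iα}R)] - P[𝒞_δ(R)]| ≤ ε/3 + ε/3 ≤ ε` for every `α ∈ (ε, π - ε) ⊆ [0, π]`.

## References

* [DKKMO2020Rotational] H. Duminil-Copin, K. K. Kozlowski, D. Krachun, I. Manolescu, M. Oulamara,
  *Rotational invariance in critical planar lattice models*, arXiv:2012.11672v1 (2020), Cor. 1.3,
  §1.3 (rotations as multiplication by `e^{iα}`).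
* [arXiv201211672v2] the same, arXiv:2012.11672v2 (30 June 2026): Thm. 1.1 (`d_CN ≤ Cδ^c` for all
  `α ∈ [0, 2π]`; `d_SS → 0`), Cor. 1.3 (per-angle crossing probabilities, `α ∈ [0, π]`) and the
  remark following it ("may be proved to be uniform in `α ∈ [0, π]`"); §7 (proof of Cor. 1.3:
  "follows directly from Corollary 1.2 and the measurability of `𝒞(Q)` in the Schramm–Smirnov
  topology").
* [SchrammSmirnov2011] O. Schramm, S. Smirnov, Ann. Probab. 39 (2011), arXiv:1101.5820, §1.3,
  Lemma 5.1, eq. (5.1).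
-/

noncomputable section

open Set Filter Metric
open _root_.MeasureTheory _root_.Topology
open scoped ENNReal unitInterval
open Literature.Probability.LatticeModels Literature.Probability.RandomPlanarGeometry

namespace Literature.Probability.Percolation

open QuadCrossing

/-! ### All angles, and the per-angle form, from the vendored statement -/

/-- **The bound of `dkkmo_crossing_rotation_invariance` holds for all real angles at once.**
For every quad `R` and `ε > 0` there is `δ₀ > 0` such that
`|P_{1/2}[𝒞_δ(e^{iα}R)] - P_{1/2}[𝒞_δ(R)]| ≤ ε` for EVERY `α ∈ ℝ` and `δ ∈ (0, δ₀)`: the crossing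
probability of `e^{iα}R` has period `π/2` in `α` (symmetries of `ℤ²`,
`quadCrossingProb_rotateQuad_add_int_mul_pi_div_two`), and every real angle is congruent modulo
`π/2` to an angle of `(ε', π - ε')`, `ε' = min ε (π/8)`, where the vendored statement applies.
[cite: DKKMO2020Rotational, Cor. 1.3 (q = 1), with §1.3 (lattice symmetries)] -/
theorem dkkmo_crossing_rotation_invariance.forall_angle (h : dkkmo_crossing_rotation_invariance)
    (R : ConformalRectangle) {ε : ℝ} (hε : 0 < ε) :
    ∃ δ₀ : ℝ, 0 < δ₀ ∧ ∀ (α : ℝ), ∀ δ ∈ Set.Ioo (0 : ℝ) δ₀,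
      |quadCrossingProb δ (rotateQuad α R) - quadCrossingProb δ R| ≤ ε := by
  set ε' : ℝ := min ε (Real.pi / 8) with hε'
  have hε'pos : 0 < ε' := lt_min hε (by positivity)
  have hε'le : ε' ≤ ε := min_le_left _ _
  have hε'pi : ε' ≤ Real.pi / 8 := min_le_right _ _
  obtain ⟨δ₀, hδ₀, hb⟩ := h R ε' hε'pos
  refine ⟨δ₀, hδ₀, fun α δ hδ => ?_⟩
  have hpi2 : (0 : ℝ) < Real.pi / 2 := by positivity
  -- reduce the angle modulo `π/2`: `α = α₀ + k π/2` with `α₀ ∈ [0, π/2)`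
  set r : ℝ := α / (Real.pi / 2) with hr
  set k : ℤ := ⌊r⌋ with hk
  set α₀ : ℝ := Int.fract r * (Real.pi / 2) with hα₀
  have hαeq : α = α₀ + k * (Real.pi / 2) := by
    have h1 : Int.fract r + (k : ℝ) = r := Int.fract_add_floor r
    have h2 : α = r * (Real.pi / 2) := by rw [hr]; field_simp
    rw [h2, ← h1]; ring
  have hα₀nn : 0 ≤ α₀ := mul_nonneg (Int.fract_nonneg r) hpi2.le
  have hα₀lt : α₀ < Real.pi / 2 := by
    have := Int.fract_lt_one r
    calc α₀ = Int.fract r * (Real.pi / 2) := rfl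
      _ < 1 * (Real.pi / 2) := by gcongr
      _ = Real.pi / 2 := one_mul _
  rw [hαeq, abs_quadCrossingProb_rotateQuad_add_int_mul_pi_div_two_sub]
  by_cases hcase : ε' < α₀
  · -- `α₀ ∈ (ε', π - ε')`
    exact (hb α₀ ⟨hcase, by linarith⟩ δ hδ).trans hε'le
  · -- `α₀ ≤ ε'`: use `α₀ + π/2 ∈ (ε', π - ε')`
    have hcase : α₀ ≤ ε' := not_lt.1 hcase
    have e := abs_quadCrossingProb_rotateQuad_add_int_mul_pi_div_two_sub δ α₀ R 1
    rw [Int.cast_one, one_mul] at e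
    rw [← e]
    refine (hb (α₀ + Real.pi / 2) ⟨by linarith, by linarith [Real.pi_pos]⟩ δ hδ).trans hε'le

/-- **The per-angle form (DKKMO v2, Cor. 1.3 at `q = 1` in the plane) from the vendored
statement**: for every quad `R` and every real angle `α`,
`P_{1/2}[𝒞_δ(e^{iα}R)] - P_{1/2}[𝒞_δ(R)] → 0` as `δ → 0⁺`.
[cite: arXiv201211672v2, Cor. 1.3 (q = 1, Ω = ℝ²)] -/
theorem dkkmo_crossing_rotation_invariance.tendsto_sub (h : dkkmo_crossing_rotation_invariance)
    (R : ConformalRectangle) (α : ℝ) :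
    Tendsto (fun δ => quadCrossingProb δ (rotateQuad α R) - quadCrossingProb δ R)
      (𝓝[>] 0) (𝓝 0) := by
  rw [Metric.tendsto_nhdsWithin_nhds]
  intro e he
  obtain ⟨δ₀, hδ₀, hb⟩ := h.forall_angle R (half_pos he)
  refine ⟨δ₀, hδ₀, fun {δ} hδ hdist => ?_⟩
  rw [Real.dist_eq, sub_zero] at hdist ⊢
  have hδpos : 0 < δ := hδ
  have hδlt : δ < δ₀ := (le_abs_self δ).trans_lt hdist
  exact (hb α δ ⟨hδpos, hδlt⟩).trans_lt (half_lt_self he)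

/-! ### The rotated quad of a conformal rectangle in `𝒬_ℂ` -/

section Rotated

variable {R : ConformalRectangle} {Q : Quad (univ : Set ℂ)}

/-- The carrier of `e^{iθ} ∘ Q` is the closed quad of `e^{iθ}R` when that of `Q` is the closed
quad of `R` (a private copy of `carrier_mapHomeomorph_rotation` of
`QuadCrossingRotationInvarianceOfThm21.lean`, kept local to avoid the import). [folklore] -/
private theorem carrier_mapHomeomorph_rotation' (hc : Q.carrier = closure R.carrier) (θ : ℝ) :
    (Q.mapHomeomorph (rotation (Circle.exp θ)).toHomeomorph).carrier =
      closure (rotateQuad θ R).carrier := by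
  rw [Quad.carrier_mapHomeomorph, hc, carrier_rotateQuad, Homeomorph.image_closure]
  rfl

/-- The sides of `e^{iθ} ∘ Q` are the arcs of `e^{iθ}R` when those of `Q` are the arcs of `R`
(private copy of `side_mapHomeomorph_rotation`, same file). [folklore] -/
private theorem side_mapHomeomorph_rotation' {k : Fin 4} (hk : Q.side k = R.arc k) (θ : ℝ) :
    (Q.mapHomeomorph (rotation (Circle.exp θ)).toHomeomorph).side k = (rotateQuad θ R).arc k := by
  rw [Quad.side_mapHomeomorph, hk, arc_rotateQuad]
  rfl

/-- `θ ↦ e^{iθ} ∘ Q` is continuous from `ℝ` to `𝒬_ℂ` (uniform metric): `(θ, z) ↦ e^{iθ} Q(z)` is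
jointly continuous on `ℝ × [0,1]²`. [folklore] -/
theorem QuadCrossing.Quad.continuous_mapHomeomorph_rotation (Q : Quad (univ : Set ℂ)) :
    Continuous fun θ : ℝ => Q.mapHomeomorph (rotation (Circle.exp θ)).toHomeomorph := by
  refine continuous_induced_rng.mpr ?_
  refine ContinuousMap.continuous_of_continuous_uncurry _ ?_
  have hf : (Function.uncurry fun (θ : ℝ) (z : I × I) =>
      ((Quad.toContinuousMap ∘ fun θ : ℝ =>
        Q.mapHomeomorph (rotation (Circle.exp θ)).toHomeomorph) θ) z) =
      fun p : ℝ × (I × I) => ((Circle.exp p.1 : Circle) : ℂ) * Q p.2 := by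
    funext p
    rfl
  rw [hf]
  exact (continuous_subtype_val.comp (Circle.exp.continuous.comp continuous_fst)).mul
    (Q.continuous_toFun.comp continuous_snd)

/-- **Sandwiched rotated quads have comparable crossing events.**  If the quad `Q` of `R` satisfies
`Q' < e^{iγ} ∘ Q` and `e^{iγ'} ∘ Q < Q''` in Schramm–Smirnov's order, then, at any mesh `δ > 0`,
`𝒞_δ(e^{iγ}R) ∖ 𝒞_δ(e^{iγ'}R) ⊆ {Q' crossed inside the open edges ∧ Q'' not}`: a path crossing
of `e^{iγ}R` puts `e^{iγ} ∘ Q` in `S_ω`, which yields a raw crossing of `Q'`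
(`Quad.exists_isCrossing_of_mem_closure`); a raw crossing of `Q''` would put `Q''` in `S_ω` and
give a path crossing of `e^{iγ'}R` (`setOf_mem_z2QuadConfig_subset_quadCrossing`).
[cite: SchrammSmirnov2011, §1.3 and proof of Lemma 5.1] -/
theorem quadCrossing_rotateQuad_diff_subset (hc : Q.carrier = closure R.carrier)
    (h0 : Q.side 0 = R.arc 0) (h2 : Q.side 2 = R.arc 2) {Q' Q'' : Quad (univ : Set ℂ)} {γ γ' δ : ℝ}
    (hγ : Q'.StrictlyDominated (Q.mapHomeomorph (rotation (Circle.exp γ)).toHomeomorph))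
    (hγ' : (Q.mapHomeomorph (rotation (Circle.exp γ')).toHomeomorph).StrictlyDominated Q'')
    (hδ : 0 < δ) :
    quadCrossing (rotateQuad γ R) δ \ quadCrossing (rotateQuad γ' R) δ ⊆
      {ω | (∃ K, Q'.IsCrossing K ∧ K ⊆ openEdgeUnion δ ω) ∧
        ¬ ∃ K, Q''.IsCrossing K ∧ K ⊆ openEdgeUnion δ ω} := by
  rintro ω ⟨hA, hB⟩
  constructor
  · have hS := quadCrossing_subset_setOf_mem_z2QuadConfig (carrier_mapHomeomorph_rotation' hc γ)
      (side_mapHomeomorph_rotation' h0 γ) (side_mapHomeomorph_rotation' h2 γ) δ hA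
    have hS' : Q.mapHomeomorph (rotation (Circle.exp γ)).toHomeomorph ∈
        (z2QuadConfig univ δ ω : Set (Quad (univ : Set ℂ))) := hS
    rw [coe_z2QuadConfig] at hS'
    exact Quad.exists_isCrossing_of_mem_closure hγ hS'
  · rintro ⟨K, hK, hKO⟩
    exact hB (setOf_mem_z2QuadConfig_subset_quadCrossing (carrier_mapHomeomorph_rotation' hc γ')
      (side_mapHomeomorph_rotation' h0 γ') (side_mapHomeomorph_rotation' h2 γ') hγ' hδ
      (mem_z2QuadConfig_of_isCrossing hK hKO))

end Rotated

/-! ### Uniformity in the angle from the per-angle form and Schramm–Smirnov continuity -/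

/-- **DKKMO v2's per-angle Corollary 1.3 implies the uniform (v1) statement, given the continuity
of crossing events** (the remark "The convergence in Corollary 1.3 may be proved to be uniform in
`α ∈ [0, π]`" after v2's Cor. 1.3, proved here for `q = 1` in the plane).  Hypotheses: `hpt`, the
per-angle convergence `P_{1/2}[𝒞_δ(e^{iα}R)] - P_{1/2}[𝒞_δ(R)] → 0` (`δ → 0⁺`) for every quad `R`
and `α ∈ [0, π]` (v2 Cor. 1.3 at `q = 1`, `Ω = ℝ²`); `hcont`, Schramm–Smirnov's discrete
continuity (5.1) of the crossing event of a fixed quad of the plane (the hypothesis of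
`SchrammSmirnov2011_lemma_5_1_of_continuity` at `D = univ` and of
`dkkmo_crossing_rotation_invariance_of_schrammSmirnov`).  Proof in the module docstring (finite
subcover of `[0, π]` by angle windows on which the crossing probabilities are `ε/3`-constant).
[cite: arXiv201211672v2, Cor. 1.3 and the remark following it] -/
theorem dkkmo_crossing_rotation_invariance_of_tendsto_of_continuity
    (hpt : ∀ (R : ConformalRectangle), ∀ α ∈ Set.Icc (0 : ℝ) Real.pi,
      Tendsto (fun δ => quadCrossingProb δ (rotateQuad α R) - quadCrossingProb δ R)
        (𝓝[>] 0) (𝓝 0))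
    (hcont : ∀ (Q₀ : Quad (univ : Set ℂ)) (ε : ℝ≥0∞), 0 < ε →
      ∃ Q' Q'' : Quad (univ : Set ℂ), Quad.StrictlyDominated Q' Q₀ ∧ Quad.StrictlyDominated Q₀ Q'' ∧
        ∃ δ₀ : ℝ, 0 < δ₀ ∧ ∀ δ : ℝ, 0 < δ → δ < δ₀ →
          bondPercolation (zdGraph 2) half
            {ω | (∃ K, Q'.IsCrossing K ∧ K ⊆ openEdgeUnion δ ω) ∧
              ¬ ∃ K, Q''.IsCrossing K ∧ K ⊆ openEdgeUnion δ ω} ≤ ε) :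
    dkkmo_crossing_rotation_invariance := by
  intro R ε hε
  -- the quad of `R` and its rotations
  obtain ⟨Φ, hΦ⟩ := exists_isSquareModel R
  have hc : (squareModelQuad Φ).carrier = closure R.carrier := hΦ.carrier_squareModelQuad
  have h0 : (squareModelQuad Φ).side 0 = R.arc 0 := hΦ.side_zero_squareModelQuad
  have h2 : (squareModelQuad Φ).side 2 = R.arc 2 := hΦ.side_two_squareModelQuad
  set Q : Quad (univ : Set ℂ) := squareModelQuad Φ
  set Qr : ℝ → Quad (univ : Set ℂ) :=
    fun θ => Q.mapHomeomorph (rotation (Circle.exp θ)).toHomeomorph with hQr_def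
  have hQr : Continuous Qr := Q.continuous_mapHomeomorph_rotation
  have hε3 : 0 < ε / 3 := by positivity
  set μ : Measure (BondConfig (Site 2)) := bondPercolation (zdGraph 2) half
  -- angle windows on which the crossing probabilities are `ε/3`-constant
  have key : ∀ θ : ℝ, ∃ U : Set ℝ, IsOpen U ∧ θ ∈ U ∧ ∃ δ₁ : ℝ, 0 < δ₁ ∧
      ∀ β ∈ U, ∀ β' ∈ U, ∀ δ : ℝ, 0 < δ → δ < δ₁ →
        |quadCrossingProb δ (rotateQuad β R) - quadCrossingProb δ (rotateQuad β' R)| ≤ ε / 3 := by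
    intro θ
    obtain ⟨Q', Q'', hQ'Q, hQQ'', δ₁, hδ₁, hE⟩ :=
      hcont (Qr θ) (ENNReal.ofReal (ε / 3)) (ENNReal.ofReal_pos.2 hε3)
    refine ⟨Qr ⁻¹' ({P | Q'.StrictlyDominated P} ∩ {P | P.StrictlyDominated Q''}), ?_,
      ⟨hQ'Q, hQQ''⟩, δ₁, hδ₁, fun β hβ β' hβ' δ hδ hδδ₁ => ?_⟩
    · exact ((Quad.isOpen_setOf_strictlyDominated_right Q').inter
        (Quad.isOpen_setOf_strictlyDominated_left Q'')).preimage hQr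
    · -- both differences of the two crossing events lie in `E = {Q' raw-crossed ∧ Q'' not}`
      set E : Set (BondConfig (Site 2)) := {ω | (∃ K, Q'.IsCrossing K ∧ K ⊆ openEdgeUnion δ ω) ∧
        ¬ ∃ K, Q''.IsCrossing K ∧ K ⊆ openEdgeUnion δ ω}
      have hEle : μ.real E ≤ ε / 3 := ENNReal.toReal_le_of_le_ofReal hε3.le (hE δ hδ hδδ₁)
      have h1 : quadCrossing (rotateQuad β R) δ \ quadCrossing (rotateQuad β' R) δ ⊆ E :=
        quadCrossing_rotateQuad_diff_subset hc h0 h2 hβ.1 hβ'.2 hδ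
      have h1' : quadCrossing (rotateQuad β' R) δ \ quadCrossing (rotateQuad β R) δ ⊆ E :=
        quadCrossing_rotateQuad_diff_subset hc h0 h2 hβ'.1 hβ.2 hδ
      have hA : μ.real (quadCrossing (rotateQuad β R) δ) ≤
          μ.real (quadCrossing (rotateQuad β' R) δ) + μ.real E :=
        calc μ.real (quadCrossing (rotateQuad β R) δ)
            ≤ μ.real (quadCrossing (rotateQuad β' R) δ ∪ E) :=
              measureReal_mono fun ω hω => by
                by_cases hω' : ω ∈ quadCrossing (rotateQuad β' R) δ
                · exact Or.inl hω'
                · exact Or.inr (h1 ⟨hω, hω'⟩)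
          _ ≤ _ := measureReal_union_le _ _
      have hB : μ.real (quadCrossing (rotateQuad β' R) δ) ≤
          μ.real (quadCrossing (rotateQuad β R) δ) + μ.real E :=
        calc μ.real (quadCrossing (rotateQuad β' R) δ)
            ≤ μ.real (quadCrossing (rotateQuad β R) δ ∪ E) :=
              measureReal_mono fun ω hω => by
                by_cases hω' : ω ∈ quadCrossing (rotateQuad β R) δ
                · exact Or.inl hω'
                · exact Or.inr (h1' ⟨hω, hω'⟩)
          _ ≤ _ := measureReal_union_le _ _
      rw [abs_sub_le_iff]
      constructor <;> · simp only [quadCrossingProb]; linarith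
  choose U hUo hθU δ₁ hδ₁ hU using key
  -- finite subcover of the compact angle range `[0, π]`
  have hK : IsCompact (Set.Icc (0 : ℝ) Real.pi) := isCompact_Icc
  obtain ⟨t, ht⟩ := hK.elim_finite_subcover (fun θ : Set.Icc (0 : ℝ) Real.pi => U θ.1)
    (fun θ => hUo θ.1) (fun θ hθ => mem_iUnion.2 ⟨⟨θ, hθ⟩, hθU θ⟩)
  -- pointwise thresholds at the finitely many centres
  have hptδ : ∀ θ : Set.Icc (0 : ℝ) Real.pi, ∃ d : ℝ, 0 < d ∧ ∀ δ : ℝ, 0 < δ → δ < d →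
      |quadCrossingProb δ (rotateQuad θ.1 R) - quadCrossingProb δ R| ≤ ε / 3 := by
    intro θ
    have := (Metric.tendsto_nhdsWithin_nhds.1 (hpt R θ.1 θ.2)) (ε / 3) hε3
    obtain ⟨d, hd, hd'⟩ := this
    refine ⟨d, hd, fun δ hδ hδd => ?_⟩
    have := hd' (show δ ∈ Set.Ioi (0 : ℝ) from hδ)
      (by rw [Real.dist_eq, sub_zero, abs_of_pos hδ]; exact hδd)
    rw [Real.dist_eq, sub_zero] at this
    exact this.le
  choose d hd hdU using hptδ
  -- a common positive threshold below all the finitely many ones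
  obtain ⟨δ₀, hδ₀, hδ₀le⟩ : ∃ δ₀ : ℝ, 0 < δ₀ ∧ ∀ θ ∈ t, δ₀ ≤ δ₁ θ.1 ∧ δ₀ ≤ d θ := by
    classical
    refine ⟨(insert 1 (t.image fun θ => min (δ₁ θ.1) (d θ))).min' (Finset.insert_nonempty _ _),
      ?_, fun θ hθ => ?_⟩
    · refine (Finset.lt_min'_iff _ _).2 fun x hx => ?_
      rcases Finset.mem_insert.1 hx with rfl | hx
      · exact one_pos
      · obtain ⟨θ, -, rfl⟩ := Finset.mem_image.1 hx
        exact lt_min (hδ₁ θ.1) (hd θ)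
    · have hle : (insert 1 (t.image fun θ => min (δ₁ θ.1) (d θ))).min'
          (Finset.insert_nonempty _ _) ≤ min (δ₁ θ.1) (d θ) :=
        Finset.min'_le _ _ (Finset.mem_insert_of_mem (Finset.mem_image_of_mem _ hθ))
      exact ⟨hle.trans (min_le_left _ _), hle.trans (min_le_right _ _)⟩
  refine ⟨δ₀, hδ₀, fun α hα δ hδ => ?_⟩
  -- `α ∈ [0, π]` lies in some window `U θ`, `θ ∈ t`
  have hαK : α ∈ Set.Icc (0 : ℝ) Real.pi := ⟨hε.le.trans hα.1.le, by linarith [hα.2]⟩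
  obtain ⟨θ, hθt, hαθ⟩ : ∃ θ ∈ t, α ∈ U θ.1 := by
    have := ht hαK
    simp only [mem_iUnion, exists_prop] at this
    exact this
  obtain ⟨hδ₁θ, hdθ⟩ := hδ₀le θ hθt
  calc |quadCrossingProb δ (rotateQuad α R) - quadCrossingProb δ R|
      ≤ |quadCrossingProb δ (rotateQuad α R) - quadCrossingProb δ (rotateQuad θ.1 R)| +
          |quadCrossingProb δ (rotateQuad θ.1 R) - quadCrossingProb δ R| := abs_sub_le _ _ _
    _ ≤ ε / 3 + ε / 3 :=
        add_le_add (hU θ.1 α hαθ θ.1 (hθU θ.1) δ hδ.1 (hδ.2.trans_le hδ₁θ))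
          (hdU θ δ hδ.1 (hδ.2.trans_le hdθ))
    _ ≤ ε := by linarith

/-- **The same with Schramm–Smirnov's Lemma 5.1** (the named fact `SchrammSmirnov2011_lemma_5_1`)
in place of the discrete continuity (5.1), through `Quad.continuity_of_lemma_5_1`: v2's per-angle
Corollary 1.3 on `[0, π]` and Lemma 5.1 give the uniform statement
`dkkmo_crossing_rotation_invariance`.
[cite: arXiv201211672v2, Cor. 1.3 and the remark following it] -/
theorem dkkmo_crossing_rotation_invariance_of_tendsto_of_lemma_5_1
    (hpt : ∀ (R : ConformalRectangle), ∀ α ∈ Set.Icc (0 : ℝ) Real.pi,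
      Tendsto (fun δ => quadCrossingProb δ (rotateQuad α R) - quadCrossingProb δ R)
        (𝓝[>] 0) (𝓝 0))
    (h51 : SchrammSmirnov2011_lemma_5_1) :
    dkkmo_crossing_rotation_invariance :=
  dkkmo_crossing_rotation_invariance_of_tendsto_of_continuity hpt
    fun Q₀ ε hε => Quad.continuity_of_lemma_5_1 h51 Q₀ ε hε

/-- **Equivalence of the two printed forms modulo Schramm–Smirnov continuity.**  Given the discrete
continuity (5.1) of crossing events, the uniform statement of v1's Corollary 1.3 (the named fact)
is equivalent to the per-angle statement of v2's Corollary 1.3 on `[0, π]` (`q = 1`, `Ω = ℝ²`).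
[cite: arXiv201211672v2, Cor. 1.3 and the remark following it] -/
theorem dkkmo_crossing_rotation_invariance_iff_tendsto_of_continuity
    (hcont : ∀ (Q₀ : Quad (univ : Set ℂ)) (ε : ℝ≥0∞), 0 < ε →
      ∃ Q' Q'' : Quad (univ : Set ℂ), Quad.StrictlyDominated Q' Q₀ ∧ Quad.StrictlyDominated Q₀ Q'' ∧
        ∃ δ₀ : ℝ, 0 < δ₀ ∧ ∀ δ : ℝ, 0 < δ → δ < δ₀ →
          bondPercolation (zdGraph 2) half
            {ω | (∃ K, Q'.IsCrossing K ∧ K ⊆ openEdgeUnion δ ω) ∧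
              ¬ ∃ K, Q''.IsCrossing K ∧ K ⊆ openEdgeUnion δ ω} ≤ ε) :
    dkkmo_crossing_rotation_invariance ↔
      ∀ (R : ConformalRectangle), ∀ α ∈ Set.Icc (0 : ℝ) Real.pi,
        Tendsto (fun δ => quadCrossingProb δ (rotateQuad α R) - quadCrossingProb δ R)
          (𝓝[>] 0) (𝓝 0) :=
  ⟨fun h R α _ => h.tendsto_sub R α,
    fun hpt => dkkmo_crossing_rotation_invariance_of_tendsto_of_continuity hpt hcont⟩

end Literature.Probability.Percolation

end
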